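import Literature.MathematicalPhysics.QuantumFieldTheory.Balaban1983to89.T4AxialChain
import Literature.MathematicalPhysics.QuantumFieldTheory.Balaban1983to89.T4TermFormat

/-!
# T4BirthChartTransport — transport of an observable-attached term along the renormalization-group trajectory, measured
in its BIRTH chart modulo gauge (cell `pub-balaban`, T4-DAG §6 spine estimate NE1′ = O3b/H2 "dressed stability in the
observable-attached format", prover seat P1 = row `T4-O3.E-NE1′-PROVE-P1*`, technique "RG-trajectory comparison:
extend [Balaban1987RG1] (2.18) term by term with the observable insertion, tracking μ-uniformity through the printed
small-field bounds"; it serves the located obligation O-G1 of `t4/T4-EST-O3Eiiib.md` §5 = O-γ2a of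
`t4/T4-EST-O3Ei-gamma2.md` = (β2) of `t4/T4-EST-O3Ei1.md`; record `t4/T4-EST-NE1p-P1.md`)

HONEST FRAMING (cell `pub-balaban`, T4-DAG PAGE 1).  The cell's T4 target is the existence AND uniqueness of the
continuum limit of Bałaban's unit-scale averaged loop expectations on a FINITE four-torus, at rung (B)+1 of the cell's
ladder: CONDITIONAL on the perturbative β-function hypothesis BetaPertH and on the running-coupling hypotheses (B)/(B^μ)
wherever a consumer uses them (none is used IN this file — every statement here is either an elementary lemma on
abstract data or real arithmetic); it is NOT an infinite-volume statement, NOT the Yang–Mills mass gap and NOT the Clay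
problem.  NO statement about Bałaban's renormalization-group objects is asserted: the birth slice, the gauge invariance
and the relative gauge below are HYPOTHESIS SHAPES on abstract data, to be supplied (or refuted) by the seats that own
the dressed term format (`T4GatedBooking.BirthBound`, `T4PreservedUnderT`, `T4Relinearisation`).

v1.1 = DOCFIX (docstring-only; no declaration changed) after XREAD C-pv20-33 (pv20-g10, verdict ok-docfix): the five
header quotations M1–M5 of v1 are replaced by the PRINT strings (renders p012/p014/p015/p024/p028 read as images by the
reader), the reading note O2 on the chart lemma's first-order term is added to (2), R1 (the printed twin (3.15)–(3.17)
of `slice_bound`) is cited; C-ne1p1-2 is RESOLVED (the (1.19) glyph is Gᶜ).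

THE QUESTION (O-G1, non-abelian transport).  A first-order observable-attached term `D` is BORN at scale `j` (at an
ℝ-step, [Balaban1989LargeFieldI] (1.76)/(1.100)) as an analytic function on the birth space `𝔘ᶜ_j(X, α₀, α₁)` of
[Balaban1987RG1] (1.10)–(1.16) p. 262, bounded there by its birth size `A_b ∼ θ₁^{K−j}` (first-order source rate,
`t4/T4-EST-O3cE2.md`).  At a later scale `k > j` it is CARRIED (print, [Balaban1987RG1] p. 260: "The k-th action
A_k(V) depends on V through the minimal configuration U_k(V), A_k(V) = A_k(U_k(V))", and display (1.3) there writes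
every term as a function of `U_k`; spectator-exact through 𝕋-steps, `T4Spectator`), and the hierarchical booking
(T4-REF-O3 V4; `T4TermFormat.Booking`, `T4PreservedUnderT` §7) needs the size of its RESPONSE to a unit scale-`k`
fluctuation to decay like `A_b·ρ^{k−j}` with `Λ·ρ·θ₁ < 1` strictly (`Λ = L⁴` positional count, `θ₁ = L⁻³`), i.e.
`ρ < L⁻¹` — the sibling toy `T4Relinearisation` shows the per-step version `Transport ρ` FALSE (re-reading a frozen
amplitude in the next linearisation can GROW it, 4 → 5.81 across a block boundary) and asks (O-γ2a/O-G1) whether the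
k-step version `TransportFrom ρ C` with a `k`-INDEPENDENT `C` holds "non-abelian, at a non-flat background".

THE ANSWER RECORDED HERE (the cell's construct, labelled; the mechanism is PRINTED for Bałaban's own terms).
(1) MEASURE IN THE BIRTH CHART.  The carried term is still the birth function; only the argument moved.  Its
    analyticity radius is the BIRTH radius — conditions (i)–(iii) of [Balaban1987RG1] p. 262 in the `j`-frame
    (`ξ = L^{−j}`) with "positive, absolute constants α₀, α₁ (i.e., constants independent of X and j)" (p. 263) — and a
    unit scale-`k` fluctuation is, in the `j`-frame, a direction of window norm `O(L^{j}η) = O(L^{−(k−j)})`: PRINTED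
    for Bałaban's terms as "(3.30) … B = Q(ηA)", "By the definiton of B and by the inequalities (3.32) we have
    |B| < O(1)L^{j}η, hence we expect that this term can be bounded by O(1)exp(−κd_j(X))(O(1)L^{j}η)⁵. (3.35)"
    (p. 277), first order "(3.17)" with the factor `L^{j}η` (p. 273), and in [Balaban1988RG2Cluster] (1.24) p. 7 the
    remainder carries "(α₁/α₃)⁵(L^{j}η)⁵", summed over `j` on p. 8 ("bounded by 2(6L)⁴").  Cauchy along the slice
    (REUSED: `T4AxialChain.norm_sub_le_of_segment`, from `Dimock2015.real_param_lipschitz`) then gives the RAW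
    birth-chart rate `ρ_raw = L⁻¹` with the constant `4A_b/α₁`: ABSOLUTE.  (`slice_bound`.)
(2) QUOTIENT BY THE GAUGE GROUP.  The birth function is invariant under COMPLEX gauge transformations — PRINTED
    format for Bałaban's densities (p. 263): "We assume that all functions 𝐄^{(j)}(X, g_{j−1}, 𝐔, 𝐉) are gauge
    invariant with respect to the group of all gauge transformations (1.10). Explicitly
    𝐄^{(j)}(X, g_{j−1}, 𝐔^u, R(u)𝐉) = 𝐄^{(j)}(X, g_{j−1}, 𝐔, 𝐉) (1.19) for all Gᶜ-valued gauge transformations u."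
    (the glyph is Gᶜ — XREAD C-pv20-33, render p015 read as image), "The spaces 𝔘ᶜ_j(X, α₀, α₁) are, by the
    definition, gauge invariant also." (p. 263), and USED by Bałaban exactly this way at (3.37) p. 277: "Assume now
    that B₃²O(1)Mα₀ < ½α₁, then the orbit of the configuration U_j(□₀, …) above contains the configuration
    exp iξ𝐇_j(…) satisfying the conditions (i), (ii)".  So the direction may be replaced by any gauge-equivalent one —
    in particular by the TRANSVERSE (relative covariant axial gauge) representative, whose `j`-window norm is
    controlled by the `j`-frame CURVATURE CHANGE of the moved configuration times a lattice-Poincaré constant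
    `C_P(R) = O(R)` of the region ([Balaban1985Averaging] (44)–(47), [Balaban1985RegularSpaces] Lemma 1, kernel count
    `T4AxialChain` §3 and `T4RelativeLadder`: LINEAR in the diameter).  THE CELL'S INPUT (I4) is that this curvature
    change is `O((L^{j}η)²)` in the `j`-frame (2-form scaling).  READING NOTE (XREAD C-pv20-33 O2, chart owner pv20):
    the chart lemma `T4DirectionChart.norm_movedPlaq_sub_one_le_xi_sq` (`‖movedPlaq − 1‖ ≤ ξ²(δ_b + 2σa′ + 16σ²a²)`)
    gives the CHANGE part `ξ²σ(2a′ + 16σa²)`, FIRST order in the chart parameter `σ` with coefficient the direction's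
    covariant-curl bound `a′`; the `O((L^{j}η)²)` reading therefore needs `a′` one factor `L^{j}η` down as well — a
    2-form / averaging scaling of `B = Q(ηA)` that is NOT among the printed window bounds (3.31)/(3.32) (they bound
    `|∇^η𝐀|` by `α₂`-type constants).  That scaling is PART OF INPUT (I4) (record §4 (O2d)), not supplied by the chart
    lemma or by this file.  Rate: `ρ_⊥ = L⁻² = φ`, constant `4A_b·C_P(R)·c₂/α₁`: absolute × O(R).
    (`transport_of_birthChart`.)
(3) THE 2 × 2 RATE TABLE (§2, [arith]): chart ∈ {current (radius `α₁·L^{−(k−j)}` in `j`-units), birth (radius `α₁`)}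
    × direction ∈ {raw `∝ L^{−(k−j)}`, transverse `∝ L^{−2(k−j)}`} gives per-order rates {1, L⁻¹; L⁻¹, L⁻²}.  With the
    cell's budget `Λ = L⁴`, `θ₁ = L⁻³` (§3): rate 1 ⇒ product `L` (divergent: the per-step toy's failure, which
    measures in the CURRENT chart); raw birth rate ⇒ product EXACTLY 1 (borderline: passes the weighted budget
    `T4TermFormat.Booking.cubeBudget_of_twoRate`, which needs only `Λφτ ≤ 1`, but is broken by ANY regeneration
    `c′ > 0`, `product_raw_regen`); transverse birth rate ⇒ product `L⁻¹`, leaving the regeneration room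
    `c′ < (L−1)/L²` of `T4PreservedUnderT.renewal_strictProduct_iff` (`product_perp_regen_lt_one_iff`).
    CONSEQUENCE FOR NE1′: the printed raw mechanism ALONE is insufficient as soon as ℝ-steps regenerate first-order
    terms; birth chart AND gauge quotient together give the two-rate array the booking consumes (§4).
(4) BOOKING SEAM (§4): the three hypothesis shapes at booking level — `ChartBound` (size ≤ (4·sup/r)·defect, what
    §1 delivers per term), `BirthSup` (sup ≤ Â·τ^{K−j}, the first-order source rate = `T4GatedBooking.BirthBound`'s
    format) and `DefectRate` (defect ≤ c·φ^{k−j}, the transverse direction estimate) — give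
    `Booking.SizeBound (A′·φ^{k−j}·τ^{K−j})` with `A′ = 4Âc/r` (`sizeBound_of_chart`) and hence, with the positional
    count and `Λφτ ≤ 1`, `Booking.CubeBudget w ((N₀·A′)·W)` (`cubeBudget_of_chart`) — μ-UNIFORM because `r = α₁`
    and `c = C_P(R)·c₂·α₂·s` do not depend on `j, k, K` (R enters linearly; for regions of j-diameter ≤ 100·M·R_j the
    polylog is absorbed by the weights of `T4GatedBooking` §4b, not here).
(5) NON-VACUITY (§5): a two-coordinate toy ("bond variable × gauge parameter") inhabiting all three function-level
    shapes, in which the raw direction is arbitrarily longer than the transverse one.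

WHAT THIS FILE DOES NOT CLAIM (OPEN, recorded in `t4/T4-EST-NE1p-P1.md` §4 and GAPS.md): (a) that the cell's
observable-attached D-terms HAVE the birth format on `𝔘ᶜ_j` with a `j`-independent radius and ARE invariant under
Gᶜ-valued gauge transformations (obligation O-β3-b of `t4/T4-EST-O3Ei1.md`; printed only for Bałaban's effective
densities, (1.17)–(1.19) p. 263, and for `E^{(j)}` via (3.36)–(3.54) and [Balaban1985Variational] Thm 1); (b) the
relative covariant axial gauge with constant `C_P(R) = O(R)` around an α₀-regular NON-ABELIAN base including the
commutator cross terms, inside the COMPLEX window (folklore; printed relatives [Balaban1987RG1] (1.12), (3.26),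
[Balaban1985RegularSpaces] Lemma 1; kernel chain count `T4AxialChain`); (c) the regeneration constant `c′` of ℝ-steps
(O-G2), the draw profile (O-γ2b), pairs (O-G7/O-G8), ℝ-step preservation (O3.E-iii-c); (d) anything at rung > (B)+1.
Value = the located printed mechanism + an elementary kernel lemma (Cauchy on the slice ∘ gauge quotient) + the rate
arithmetic that separates the sufficient from the insufficient chart + a typed seam into the booking; NOT summit
progress.

PRINTED LOCI (verbatim, journal pages; renders `b2b-balaban-ref1/pages/1987-cmp109-rg-I-small-field/…-p0NN-x2.png`,
NN = page − 248, and `…/1988-cmp116-rg-II-cluster/…-p00N-x2.png`; OCR text layer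
`paper:balaban1987-cmp109-rg-i-small-field` pp. 262–263, 272–277).
* [Balaban1987RG1] p. 262 (render p014 read as image by XREAD C-pv20-33; v1.1 DOCFIX M1): "The space
  𝔘ᶜ_j(X, α₀, α₁, γ₀) is a union of orbits [(𝐔, 𝐉)] determined by configurations 𝐔, 𝐉 satisfying the four conditions
  written below. (i) 𝐔 = U′U, U has values in the group G, |∂U − 1| < α₀ξ² on X, (1.11) for each cube □ ⊂ X of a size
  O(1)LM there exists a G-valued gauge transformation u defined on □ and such, that U^u = exp iξA, |A|, |∇^ξA| <
  O(1)LMBα₀ on □, (1.12) with a sufficiently large constant B (it will be determined later). (ii) U′ = exp iξA′, A′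
  has values in the algebra 𝐠ᶜ, |A′|, |∇^ξ_U A′| < α₁ on X. (1.13) (iii) The configurations 𝐔, 𝐉 satisfy the bounds
  |∂𝐔 − 1| < α₀ξ², |𝐉| < γ₀ on X. (1.14)" — the birth radius of this file's reading is the `α₁` of (ii) (1.13);
  p. 263: "positive, absolute constants α₀, α₁ (i.e., constants independent of X and j)"; "Usually we consider spaces
  with γ₀ = α₀, and then we omit the constant γ₀"; (v1.1 DOCFIX M2, render p015) "We assume that all functions
  𝐄^{(j)}(X, g_{j−1}, 𝐔, 𝐉) are gauge invariant with respect to the group of all gauge transformations (1.10).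
  Explicitly 𝐄^{(j)}(X, g_{j−1}, 𝐔^u, R(u)𝐉) = 𝐄^{(j)}(X, g_{j−1}, 𝐔, 𝐉) (1.19) for all Gᶜ-valued gauge
  transformations u."; "The spaces 𝔘ᶜ_j(X, α₀, α₁) are, by the definition, gauge invariant also."
  [cite: Balaban1987RG1, (1.10)–(1.19) pp. 262–263]
* [Balaban1987RG1] p. 276 (render p028; v1.1 DOCFIX M5): "Let us denote A = (1/iη) log exp iη𝐀 exp
  iL⁻¹η𝐇_{k+1}(□₀, (1/i) log V), B = Q(ηA) on □₀. (3.30)" (preceded by: obtained from (3.28) by replacing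
  (tζ̃_□ + t_□ζ_□)𝐇_k(B′) by a 𝐠ᶜ-valued variable 𝐀) — [cell notation, NOT print: the pair `U₀`, `U₁ = exp(iη𝐀)U₀`
  of this file's §1 is the cell's relative-gauge reading of this substitution]; "(3.31) |𝐀|, |∇^η𝐀|, ‖𝐀‖_{1,β} < α₂
  on □₀"; p. 277: "(3.32) |A|, |∇^ηA|, ‖A‖_{1,β} <
  2(α₂ + B₃O(1)Mα₀)", "(3.34) [Taylor expansion in B to fourth order + fifth-order integral remainder]", "Let us
  consider the last term in the expansion (3.34). By the definiton of B and by the inequalities (3.32) we have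
  |B| < O(1)L^{j}η, hence we expect that this term can be bounded by O(1)exp(−κd_j(X))(O(1)L^{j}η)⁵. (3.35) To prove
  this statement we have to go into rather lengthy considerations. The main problem is to investigate analyticity
  properties of this term on proper spaces." … "(3.37) … |H_j(□₀, τQ(…))|, |∇^ξH_j(□₀, τQ(…))| < B₃²O(1)Mα₀L^{j−1}η
  … |u_j − 1| < B₃²O(1)Mα₀. Assume now that B₃²O(1)Mα₀ < ½α₁, then the orbit of the configuration U_j(□₀, …) above
  contains the configuration exp iξH_j(…) satisfying the conditions (i), (ii) on the cube □̃³, hence on X."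
  [cite: Balaban1987RG1, (3.30)–(3.37) pp. 276–277]
* [Balaban1987RG1] p. 272 (render p024; v1.1 DOCFIX M3): "Thus, there exists a constant α₂, depending on α₀ and on
  some absolute constants, such that the function (3.13) is analytic in 𝐀, for 𝐀 satisfying the conditions |𝐀|,
  |P₁𝐀|, |∇^ξ_U𝐀|, |Δ^ξ_U𝐀| < α₂ on X. (3.14)"; p. 273 (3.15)–(3.17) (XREAD C-pv20-33 R1, the PRINTED TWIN of
  `slice_bound` for Bałaban's own first-order term: a Cauchy integral over `|t_□| = r` with the radius fixed by
  "r max{|δ𝐇_j|_X, |P₁δ𝐇_j|_X, |∇^ξ_Uδ𝐇_j|_X, |Δ^ξ_Uδ𝐇_j|_X} = ⅓α₂" and "|(3.15)| ≤ (1/r)E₀exp(−κd_j(X))", the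
  display (3.17) then carrying one factor `L^{j}η`).
  [cite: Balaban1987RG1, (3.10)–(3.17) pp. 272–273]
* [Balaban1988RG2Cluster] p. 7 (1.24): the fifth-order remainder with the factor "(α₁/α₃)⁵ (L^{j}η)⁵", "hence we
  estimate the above expression using (I.3.54)"; p. 8: the sum over birth scales `j` "bounded by 2(6L)⁴".
  [cite: Balaban1988RG2Cluster, (1.21)–(1.25) pp. 7–8]

LABELS. [printed] = quoted above; [folklore] = elementary complex analysis / bookkeeping on abstract data and
real arithmetic (the gate's tag; sections §2–§3 are pure arithmetic); [cell] = the cell's reading (identification of hypotheses with Bałaban's objects — NEVER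
asserted in Lean).  No `sorry`, no new axioms.
-/

namespace Literature.MathematicalPhysics.QuantumFieldTheory.Balaban1983to89.T4BirthChartTransport

open Set Metric Finset

/-! ## §1  The gauge-quotient transport lemma along a birth chart (function level, abstract data) -/

section FunctionLevel

variable {𝒰 Dir F : Type*} [NormedAddCommGroup F] [NormedSpace ℂ F] [CompleteSpace F]

/-- HYPOTHESIS SHAPE — GAUGE INVARIANCE of a carried function `Fn` under a relation `rel` on configurations
(intended reading [cell]: `rel U U'` iff `U' = U^u` for a Gᶜ-valued gauge transformation `u` close to a G-valued
one; PRINTED format for Bałaban's effective densities, [Balaban1987RG1] (1.19) p. 263, used at (3.37) p. 277; for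
the cell's observable-attached terms it is obligation O-β3-b, NOT printed). [folklore] -/
def GaugeInvariant (rel : 𝒰 → 𝒰 → Prop) (Fn : 𝒰 → F) : Prop :=
  ∀ U U', rel U U' → Fn U = Fn U'

/-- HYPOTHESIS SHAPE — BIRTH SLICE.  `move U d t` moves the base configuration `U` along the direction `d` with
complex coefficient `t` (intended [cell]: `U ↦ exp(i ξ_j t 𝐀) U` in the BIRTH frame, `N d` = the `j`-window norm
`max(|𝐀|, |∇𝐀|, ‖𝐀‖_{1,β})` of [Balaban1987RG1] (3.31)); for every base in `𝒦` (the real regular configurations)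
and every direction inside the window `N d ≤ w` (`w` = α₂-type), the slice `t ↦ Fn (move U d t)` is complex
differentiable and bounded by `A` on a set containing the closed discs of radius `r / N d` about `[0, 1]` (`r` =
α₁-type BIRTH radius — `j`-INDEPENDENT, "absolute constants … independent of X and j", p. 263). [folklore] -/
def BirthSlice (Fn : 𝒰 → F) (move : 𝒰 → Dir → ℂ → 𝒰) (N : Dir → ℝ) (𝒦 : Set 𝒰) (w r A : ℝ) : Prop :=
  ∀ U ∈ 𝒦, ∀ d : Dir, 0 < N d → N d ≤ w →
    ∃ Dm : Set ℂ, DifferentiableOn ℂ (fun t : ℂ => Fn (move U d t)) Dm ∧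
      (∀ t ∈ Dm, ‖Fn (move U d t)‖ ≤ A) ∧ ∀ s ∈ Icc (0 : ℝ) 1, closedBall (s : ℂ) (r / N d) ⊆ Dm

/-- HYPOTHESIS SHAPE — RELATIVE GAUGE of defect `δ`: `U₁` is `rel`-related to the chart image `move U₀ d 1` of the base
along SOME direction of window norm `≤ δ` (intended [cell]: the relative covariant axial gauge / lattice Poincaré
step — `δ = C_P(R) ×` the `j`-frame curvature change of the moved configuration; folklore, NOT printed in this form;
printed relatives [Balaban1985Averaging] (44)–(47), [Balaban1985RegularSpaces] Lemma 1, [Balaban1987RG1] (3.37)). [folklore] -/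
def RelGauge (rel : 𝒰 → 𝒰 → Prop) (move : 𝒰 → Dir → ℂ → 𝒰) (N : Dir → ℝ) (U₀ U₁ : 𝒰) (δ : ℝ) : Prop :=
  ∃ d : Dir, 0 < N d ∧ N d ≤ δ ∧ rel U₁ (move U₀ d 1)

variable {Fn : 𝒰 → F} {rel : 𝒰 → 𝒰 → Prop} {move : 𝒰 → Dir → ℂ → 𝒰} {N : Dir → ℝ} {𝒦 : Set 𝒰}
  {w r A δ : ℝ}

/-- RAW SLICE BOUND (Cauchy along the birth slice): inside the window, `‖Fn (move U d 1) − Fn U‖ ≤ (4A/r)·N d` — the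
constant `4A/r` is the birth sup over the BIRTH radius, hence scale-independent; the rate is whatever `N d` is.  For
a unit scale-`k` fluctuation read in the `j`-frame, `N d = O(L^{−(k−j)})` ([Balaban1987RG1] p. 277 "|B| < O(1)L^{j}η"):
the RAW birth-chart rate `L⁻¹` per order.  REUSES `T4AxialChain.norm_sub_le_of_segment`. [folklore] -/
theorem slice_bound (hsl : BirthSlice Fn move N 𝒦 w r A) (hmove : ∀ U d, move U d 0 = U) (hr : 0 < r)
    {U : 𝒰} (hU : U ∈ 𝒦) {d : Dir} (hd : 0 < N d) (hdw : N d ≤ w) :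
    ‖Fn (move U d 1) - Fn U‖ ≤ 4 * A / r * N d := by
  obtain ⟨Dm, hdiff, hA, hD⟩ := hsl U hU d hd hdw
  have h : ‖Fn (move U d 1) - Fn (move U d 0)‖ ≤ 4 * A / (r / N d) :=
    T4AxialChain.norm_sub_le_of_segment (g := fun t : ℂ => Fn (move U d t)) (div_pos hr hd) hdiff hA hD
  rw [hmove] at h
  calc ‖Fn (move U d 1) - Fn U‖ ≤ 4 * A / (r / N d) := h
    _ = 4 * A / r * N d := by rw [div_div_eq_mul_div]; ring

/-- A `rel`-reflexive chart endpoint is trivially in relative gauge with its own raw defect: the RAW direction is one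
admissible witness (so `transport_of_birthChart` contains the raw bound `slice_bound`). [folklore] -/
theorem relGauge_of_move (hrefl : ∀ U, rel U U) {U₀ : 𝒰} {d : Dir} (hd : 0 < N d) :
    RelGauge rel move N U₀ (move U₀ d 1) (N d) :=
  ⟨d, hd, le_rfl, hrefl _⟩

/-- Monotonicity of the defect. [folklore] -/
theorem RelGauge.mono {U₀ U₁ : 𝒰} {δ δ' : ℝ} (h : RelGauge rel move N U₀ U₁ δ) (hle : δ ≤ δ') :
    RelGauge rel move N U₀ U₁ δ' := by
  obtain ⟨d, hd, hdδ, hr⟩ := h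
  exact ⟨d, hd, hdδ.trans hle, hr⟩

/-- THE GAUGE-QUOTIENT TRANSPORT LEMMA.  A gauge-invariant function with a birth slice of radius `r` and sup `A`
moves, between a regular base `U₀` and ANY configuration `U₁` in relative gauge of defect `δ ≤ w` with it, by at most
`(4A/r)·δ`.  With `δ = δ_⊥ = C_P(R)·c₂·s·L^{−2(k−j)}` (transverse representative) this is the rate `φ = L⁻²` per
order with the `k`-independent constant `4A·C_P(R)c₂s/r` — the shape `T4Relinearisation.Relin.TransportFrom φ C`
asks for (O-γ2a/O-G1), on abstract data.  Every analytic and gauge-theoretic input is a hypothesis. [folklore] -/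
theorem transport_of_birthChart (hinv : GaugeInvariant rel Fn) (hsl : BirthSlice Fn move N 𝒦 w r A)
    (hmove : ∀ U d, move U d 0 = U) (hr : 0 < r) (hA : 0 ≤ A) {U₀ U₁ : 𝒰} (hU₀ : U₀ ∈ 𝒦)
    (hrel : RelGauge rel move N U₀ U₁ δ) (hδw : δ ≤ w) : ‖Fn U₁ - Fn U₀‖ ≤ 4 * A / r * δ := by
  obtain ⟨d, hd, hdδ, hr1⟩ := hrel
  rw [hinv _ _ hr1]
  calc ‖Fn (move U₀ d 1) - Fn U₀‖ ≤ 4 * A / r * N d := slice_bound hsl hmove hr hU₀ hd (hdδ.trans hδw)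
    _ ≤ 4 * A / r * δ := mul_le_mul_of_nonneg_left hdδ (by positivity)

omit [NormedSpace ℂ F] [CompleteSpace F] in
/-- Degenerate case: exactly gauge-equivalent configurations carry the same value. [folklore] -/
theorem sub_eq_zero_of_rel (hinv : GaugeInvariant rel Fn) {U₀ U₁ : 𝒰} (h : rel U₁ U₀) : Fn U₁ - Fn U₀ = 0 := by
  rw [hinv _ _ h, sub_self]

omit [CompleteSpace F] in
/-- `A` in `BirthSlice` bounds the base value too (the slice passes through `t = 0`), whenever some admissible direction
exists; recorded so that consumers may take `A` = the birth size. [folklore] -/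
theorem norm_base_le (hsl : BirthSlice Fn move N 𝒦 w r A) (hmove : ∀ U d, move U d 0 = U) (hr : 0 ≤ r)
    {U : 𝒰} (hU : U ∈ 𝒦) {d : Dir} (hd : 0 < N d) (hdw : N d ≤ w) : ‖Fn U‖ ≤ A := by
  obtain ⟨Dm, -, hA, hD⟩ := hsl U hU d hd hdw
  have h0 : (0 : ℂ) ∈ Dm := hD 0 ⟨le_rfl, zero_le_one⟩ (by simpa using div_nonneg hr hd.le)
  simpa [hmove] using hA 0 h0

end FunctionLevel

/-! ## §2  Frame conversion: the 2 × 2 rate table (chart × direction) [arith]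

`n = k − j` orders after birth.  In BIRTH (`j`-frame) units a unit scale-`k` fluctuation has raw window norm
`c₁·s·ν^n`, `ν = L⁻¹` ("|B| < O(1)L^{j}η", [Balaban1987RG1] p. 277), and its transverse (relative-gauge) representative
has window norm `c₂·s·(ν^n)²` (curvature change is quadratic in the frame ratio, `T4DirectionChart.norm_movedPlaq_sub_one_le_xi_sq`).
The BIRTH chart has radius `r` (α₁, absolute); the CURRENT chart (analyticity known only in scale-`k` units) has, in
`j`-units, radius `r·ν^n`.  Response bound = `4·A / radius × defect` (§1). -/

section Frames

/-- The frame ratio `ν^n = L^{−(k−j)}`: fine-lattice spacing seen from scale `k` over that seen from the birth scale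
`j` (`η / ξ_j`). [folklore] -/
noncomputable def frameRatio (L : ℝ) (n : ℕ) : ℝ := L⁻¹ ^ n

/-- `(ν^n)² = φ^n` with `φ = (L²)⁻¹` (REUSES `T4AxialChain.inv_pow_sq_eq`). [folklore] -/
theorem frameRatio_sq (L : ℝ) (n : ℕ) : frameRatio L n ^ 2 = (L ^ 2)⁻¹ ^ n :=
  T4AxialChain.inv_pow_sq_eq L n

/-- Positivity of the frame ratio. [folklore] -/
theorem frameRatio_pos {L : ℝ} (hL : 0 < L) (n : ℕ) : 0 < frameRatio L n := pow_pos (inv_pos.mpr hL) n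

/-- The response bound of §1 as a function of (sup, radius, defect). [folklore] -/
noncomputable def resp (A radius defect : ℝ) : ℝ := 4 * A / radius * defect

/-- BIRTH chart, RAW direction: rate `ν = L⁻¹` per order (the PRINTED mechanism, (3.35)/(1.24)). [folklore] -/
theorem resp_birth_raw (A r c₁ s L : ℝ) (n : ℕ) :
    resp A r (c₁ * s * frameRatio L n) = 4 * A * c₁ * s / r * L⁻¹ ^ n := by
  unfold resp frameRatio; ring

/-- BIRTH chart, TRANSVERSE direction: rate `φ = L⁻²` per order. [folklore] -/
theorem resp_birth_perp (A r c₂ s L : ℝ) (n : ℕ) :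
    resp A r (c₂ * s * frameRatio L n ^ 2) = 4 * A * c₂ * s / r * (L ^ 2)⁻¹ ^ n := by
  rw [frameRatio_sq]; unfold resp; ring

/-- CURRENT chart, RAW direction: NO decay at all — the response bound is `n`-independent (this is what a per-step
re-measurement in the current linearisation sees; cf. the FALSE per-step shape `T4Relinearisation.Relin.Transport`). [folklore] -/
theorem resp_current_raw {r L : ℝ} (A c₁ s : ℝ) (hr : r ≠ 0) (hL : L ≠ 0) (n : ℕ) :
    resp A (r * frameRatio L n) (c₁ * s * frameRatio L n) = 4 * A * c₁ * s / r := by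
  have hν : frameRatio L n ≠ 0 := pow_ne_zero _ (inv_ne_zero hL)
  unfold resp; field_simp

/-- CURRENT chart, TRANSVERSE direction: rate `ν = L⁻¹` only. [folklore] -/
theorem resp_current_perp {r L : ℝ} (A c₂ s : ℝ) (hr : r ≠ 0) (hL : L ≠ 0) (n : ℕ) :
    resp A (r * frameRatio L n) (c₂ * s * frameRatio L n ^ 2) = 4 * A * c₂ * s / r * L⁻¹ ^ n := by
  have hν : frameRatio L n ≠ 0 := pow_ne_zero _ (inv_ne_zero hL)
  unfold resp frameRatio at *; field_simp

end Frames

/-! ## §3  Budget products with the cell's numbers `Λ = L⁴`, `θ₁ = L⁻³` [arith]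

The hierarchical cube budget converges iff `Λ·ρ·θ₁ < 1` along the geometric majorant (`T4TermFormat.Booking.cubeBudget_of_twoRate`
needs `Λφτ ≤ 1` with coupling weights; `T4PreservedUnderT.Renewal` needs the STRICT product with regeneration
`Λ(ρ + c′)θ₁ < 1`). -/

section Budget

variable {L c : ℝ}

/-- Rate 1 (current chart, raw): product `L` — divergent for `L > 1`. [folklore] -/
theorem product_noGain (hL : L ≠ 0) : L ^ 4 * 1 * L⁻¹ ^ 3 = L := by field_simp

/-- Raw birth-chart rate `L⁻¹` (the printed mechanism alone): product EXACTLY `1` — borderline. [folklore] -/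
theorem product_raw (hL : L ≠ 0) : L ^ 4 * L⁻¹ * L⁻¹ ^ 3 = 1 := by field_simp

/-- Transverse birth-chart rate `φ = L⁻²`: product `L⁻¹`. [folklore] -/
theorem product_perp (hL : L ≠ 0) : L ^ 4 * (L ^ 2)⁻¹ * L⁻¹ ^ 3 = L⁻¹ := by field_simp

/-- The raw rate is broken by ANY regeneration `c > 0`: `Λ(L⁻¹ + c)θ₁ = 1 + L·c > 1`.  Hence for NE1′ the printed
`L^{j}η`-mechanism alone does not feed `T4PreservedUnderT.Renewal`; the gauge quotient is needed. [folklore] -/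
theorem product_raw_regen (hL : 0 < L) (hc : 0 < c) : 1 < L ^ 4 * (L⁻¹ + c) * L⁻¹ ^ 3 := by
  have e : L ^ 4 * (L⁻¹ + c) * L⁻¹ ^ 3 = 1 + L * c := by field_simp
  rw [e]; nlinarith [mul_pos hL hc]

/-- The transverse rate leaves room: `Λ(φ + c)θ₁ = L⁻¹ + L·c < 1 ↔ c < (L − 1)/L²` (the threshold of
`T4PreservedUnderT.renewal_strictProduct_iff`, re-derived for the pair (raw, transverse)). [folklore] -/
theorem product_perp_regen_lt_one_iff (hL : 1 < L) :
    L ^ 4 * ((L ^ 2)⁻¹ + c) * L⁻¹ ^ 3 < 1 ↔ c < (L - 1) / L ^ 2 := by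
  have hL0 : 0 < L := by linarith
  have e : L ^ 4 * ((L ^ 2)⁻¹ + c) * L⁻¹ ^ 3 = (1 + L ^ 2 * c) / L := by field_simp
  rw [e, div_lt_iff₀ hL0, lt_div_iff₀ (by positivity)]
  constructor <;> intro h <;> nlinarith

/-- … whereas WITHOUT regeneration (pure transport through 𝕋-steps, where observable-attached terms are spectator-exact,
`T4Spectator`) the raw rate still passes the WEIGHTED budget `Booking.cubeBudget_of_twoRate`, which needs only
`Λφτ ≤ 1`: the printed mechanism is exactly borderline-sufficient there. [folklore] -/
theorem product_raw_le_one (hL : L ≠ 0) : L ^ 4 * L⁻¹ * L⁻¹ ^ 3 ≤ 1 := (product_raw hL).le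

/-- Non-strict form used by the weighted budget: `Λ·φ·θ₁ = L⁻¹ ≤ 1` for `L ≥ 1`. [folklore] -/
theorem product_perp_le_one (hL : 1 ≤ L) : L ^ 4 * (L ^ 2)⁻¹ * L⁻¹ ^ 3 ≤ 1 := by
  rw [product_perp (by positivity)]; exact inv_le_one_of_one_le₀ hL

end Budget

/-! ## §4  Booking seam: chart hypotheses ⇒ the two-rate size array ⇒ the cube budget -/

section BookingSeam

open T4TermFormat

variable (B : Booking)

/-- HYPOTHESIS SHAPE — CHART BOUND at booking level: the booked size at scale `k` of the term born at `b` is at most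
`(4·supB b / r)·defect b k` — what `transport_of_birthChart` delivers when `B.size b k` is booked as the sup over the
support cube of the response to a unit scale-`k` fluctuation (booking convention (c1) of `T4PreservedUnderT` §7),
`supB b` = birth sup, `r` = birth radius, `defect b k` = transverse window norm. [cell] reading, abstract data. [folklore] -/
def ChartBound (supB : B.Birth → ℝ) (r : ℝ) (defect : B.Birth → ℕ → ℝ) : Prop :=
  ∀ (b : B.Birth) (k : ℕ), B.birthScale b ≤ k → k ≤ B.K → B.size b k ≤ 4 * supB b / r * defect b k

/-- HYPOTHESIS SHAPE — BIRTH SUP: `supB b ≤ Â·τ^{K−j}` (first-order source rate `τ = θ₁`, the format of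
`T4GatedBooking.BirthBound`; `Â ∝ |μ|·|Λ|` absorbed). [folklore] -/
def BirthSup (supB : B.Birth → ℝ) (Ahat τ : ℝ) : Prop :=
  ∀ b : B.Birth, supB b ≤ Ahat * τ ^ (B.K - B.birthScale b)

/-- HYPOTHESIS SHAPE — DEFECT RATE: the transverse window norm of a unit scale-`k` fluctuation, in birth units, is at
most `c·φ^{k−j}` (`c = C_P(R)·c₂·α₂·s`, `φ = L⁻²`; item (b) of WHAT THIS FILE DOES NOT CLAIM). [folklore] -/
def DefectRate (defect : B.Birth → ℕ → ℝ) (c φ : ℝ) : Prop :=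
  ∀ (b : B.Birth) (k : ℕ), B.birthScale b ≤ k → k ≤ B.K → defect b k ≤ c * φ ^ (k - B.birthScale b)

variable {B}
variable {supB : B.Birth → ℝ} {defect : B.Birth → ℕ → ℝ} {r Ahat τ c φ : ℝ}

/-- THE TWO-RATE ARRAY from the chart hypotheses: `SizeBound (A′·φ^{k−j}·τ^{K−j})`, `A′ = 4Âc/r` — the array
`T4PreservedUnderT.twoRate` / the `hσle` slot of `Booking.cubeBudget_of_twoRate`, with a constant built from the birth
radius and the Poincaré/curvature constant only (μ-, j-, k-, K-uniform). [folklore] -/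
theorem sizeBound_of_chart (hr : 0 < r) (hAhat : 0 ≤ Ahat) (hτ : 0 ≤ τ) (hdef0 : ∀ b k, 0 ≤ defect b k)
    (hCB : ChartBound B supB r defect) (hBS : BirthSup B supB Ahat τ) (hDR : DefectRate B defect c φ) :
    B.SizeBound (fun j k => 4 * Ahat * c / r * φ ^ (k - j) * τ ^ (B.K - j)) := by
  intro b k hjk hk
  have h1 := hBS b
  have h2 := hDR b k hjk hk
  calc B.size b k ≤ 4 * supB b / r * defect b k := hCB b k hjk hk
    _ ≤ 4 * (Ahat * τ ^ (B.K - B.birthScale b)) / r * (c * φ ^ (k - B.birthScale b)) := by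
        have := hdef0 b k
        gcongr
    _ = 4 * Ahat * c / r * φ ^ (k - B.birthScale b) * τ ^ (B.K - B.birthScale b) := by ring

/-- THE CUBE BUDGET from the chart hypotheses + positional count + weights + `Λφτ ≤ 1`:
`CubeBudget w ((N₀·(4Âc/r))·W)` — by `T4TermFormat.Booking.cubeBudget_of_twoRate`.  With the cell's numbers
`Λ = L⁴, φ = L⁻², τ = L⁻³` the product is `L⁻¹ ≤ 1` (`product_perp_le_one`). [folklore] -/
theorem cubeBudget_of_chart {N : ℕ → ℕ → ℝ} {wt : ℕ → ℝ} {N₀ Λ W : ℝ}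
    (hw : ∀ j, j ≤ B.K → 0 ≤ wt j) (hW : ∑ j ∈ range (B.K + 1), wt j ≤ W) (hN : B.PositionalCount N)
    (hNle : ∀ j k, j ≤ k → k ≤ B.K → N j k ≤ N₀ * Λ ^ (k - j)) (hN₀ : 0 ≤ N₀) (hΛ : 0 ≤ Λ)
    (hr : 0 < r) (hAhat : 0 ≤ Ahat) (hc : 0 ≤ c) (hφ : 0 ≤ φ) (hτ : 0 ≤ τ) (hτ1 : τ ≤ 1)
    (hΛφτ : Λ * φ * τ ≤ 1) (hdef0 : ∀ b k, 0 ≤ defect b k)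
    (hCB : ChartBound B supB r defect) (hBS : BirthSup B supB Ahat τ) (hDR : DefectRate B defect c φ) :
    B.CubeBudget wt ((N₀ * (4 * Ahat * c / r)) * W) :=
  Booking.cubeBudget_of_twoRate hw hW hN (sizeBound_of_chart hr hAhat hτ hdef0 hCB hBS hDR)
    (fun j k => by positivity) hN₀ (by positivity) hΛ hφ hτ hτ1 hΛφτ hNle (fun j k _ _ => le_rfl)

/-! ### From the function level to the booking level

If the booked size `B.size b k` is (up to every `ε > 0`) ATTAINED by the response `‖Fn b U₁ − Fn b U₀‖` of the birth
function of `b` between some regular base `U₀` and some configuration `U₁` in relative gauge of defect `defect b k`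
with it — booking convention (c1) of `T4PreservedUnderT` §7 read literally — then §1 gives `ChartBound`.  So the
whole chain function level ⇒ `ChartBound` ⇒ `SizeBound (two-rate)` ⇒ `CubeBudget` is kernel-checked on abstract
data; what is NOT checked is that Bałaban's/the cell's objects inhabit the hypotheses (items (a), (b) of the header). -/

variable {𝒰 Dir F : Type*} [NormedAddCommGroup F] [NormedSpace ℂ F] [CompleteSpace F]
  {rel : 𝒰 → 𝒰 → Prop} {move : 𝒰 → Dir → ℂ → 𝒰} {N : Dir → ℝ} {𝒦 : Set 𝒰} {w : ℝ}

/-- FUNCTION LEVEL ⇒ BOOKING LEVEL: per-birth gauge-invariant birth functions with birth slices of the common radius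
`r` and sups `supB b`, sizes attained by admissible responses ⇒ `ChartBound B supB r defect`. [folklore] -/
theorem chartBound_of_response {Fn : B.Birth → 𝒰 → F} (hinv : ∀ b, GaugeInvariant rel (Fn b))
    (hsl : ∀ b, BirthSlice (Fn b) move N 𝒦 w r (supB b)) (hmove : ∀ U d, move U d 0 = U) (hr : 0 < r)
    (hsup0 : ∀ b, 0 ≤ supB b) (hdefw : ∀ b k, defect b k ≤ w)
    (hsize : ∀ (b : B.Birth) (k : ℕ), B.birthScale b ≤ k → k ≤ B.K → ∀ ε > 0, ∃ U₀ ∈ 𝒦, ∃ U₁ : 𝒰,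
      RelGauge rel move N U₀ U₁ (defect b k) ∧ B.size b k ≤ ‖Fn b U₁ - Fn b U₀‖ + ε) :
    ChartBound B supB r defect := by
  intro b k hjk hk
  refine le_of_forall_pos_le_add fun ε hε => ?_
  obtain ⟨U₀, hU₀, U₁, hrel, hle⟩ := hsize b k hjk hk ε hε
  have ht := transport_of_birthChart (hinv b) (hsl b) hmove hr (hsup0 b) hU₀ hrel (hdefw b k)
  linarith

end BookingSeam

/-! ## §5  Non-vacuity: a two-coordinate toy ("bond variable × gauge parameter") -/

section Toy

/-- Toy configurations: (bond variable, gauge parameter). [folklore] -/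
abbrev ToyCfg := ℂ × ℂ

/-- Toy gauge relation: same bond variable, any gauge parameter. [folklore] -/
def toyRel (U U' : ToyCfg) : Prop := U.1 = U'.1

/-- Toy carried function: reads the bond variable only. [folklore] -/
def toyFn (U : ToyCfg) : ℂ := U.1

/-- Toy chart: straight line in direction `d`. [folklore] -/
def toyMove (U : ToyCfg) (d : ToyCfg) (t : ℂ) : ToyCfg := (U.1 + t * d.1, U.2 + t * d.2)

/-- Toy window norm: ℓ¹ norm of the direction (gauge component INCLUDED — the raw defect). [folklore] -/
noncomputable def toyN (d : ToyCfg) : ℝ := ‖d.1‖ + ‖d.2‖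

/-- Toy regular set: bond variable of norm ≤ 1. [folklore] -/
def toyK : Set ToyCfg := {U | ‖U.1‖ ≤ 1}

/-- The toy function is gauge invariant. [folklore] -/
theorem toy_gaugeInvariant : GaugeInvariant toyRel toyFn := fun _ _ h => h

/-- The toy chart starts at the base. [folklore] -/
theorem toy_move_zero (U d : ToyCfg) : toyMove U d 0 = U := by simp [toyMove]

/-- The toy inhabits `BirthSlice` with window `w`, radius `r`, sup `1 + r + w`. [folklore] -/
theorem toy_birthSlice {w r : ℝ} (hr : 0 ≤ r) : BirthSlice toyFn toyMove toyN toyK w r (1 + r + w) := by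
  intro U hU d hd hdw
  refine ⟨closedBall 0 (1 + r / toyN d), ?_, ?_, ?_⟩
  · show DifferentiableOn ℂ (fun t : ℂ => U.1 + t * d.1) _
    exact ((differentiableOn_const _).add (differentiableOn_id.mul (differentiableOn_const _)))
  · intro t ht
    have ht' : ‖t‖ ≤ 1 + r / toyN d := by simpa using ht
    have hd1 : ‖d.1‖ ≤ toyN d := le_add_of_nonneg_right (norm_nonneg _)
    have hU1 : ‖U.1‖ ≤ 1 := hU
    have hkey : ‖t‖ * ‖d.1‖ ≤ (1 + r / toyN d) * toyN d :=
      mul_le_mul ht' hd1 (norm_nonneg _) (by positivity)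
    have hprod : (1 + r / toyN d) * toyN d = toyN d + r := by field_simp
    show ‖U.1 + t * d.1‖ ≤ 1 + r + w
    calc ‖U.1 + t * d.1‖ ≤ ‖U.1‖ + ‖t‖ * ‖d.1‖ := (norm_add_le _ _).trans (by rw [norm_mul])
      _ ≤ 1 + (toyN d + r) := by rw [← hprod]; exact add_le_add hU1 hkey
      _ ≤ 1 + r + w := by linarith
  · intro s hs t ht
    have hts : ‖t - (s : ℂ)‖ ≤ r / toyN d := by simpa [dist_eq_norm] using ht
    have hs1 : ‖(s : ℂ)‖ ≤ 1 := by
      rw [Complex.norm_real, Real.norm_eq_abs, abs_le]; exact ⟨by linarith [hs.1], hs.2⟩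
    have : ‖t‖ ≤ 1 + r / toyN d :=
      calc ‖t‖ = ‖(t - (s : ℂ)) + (s : ℂ)‖ := by rw [sub_add_cancel]
        _ ≤ ‖t - (s : ℂ)‖ + ‖(s : ℂ)‖ := norm_add_le _ _
        _ ≤ 1 + r / toyN d := by linarith
    simpa using this

/-- The toy inhabits `RelGauge` with the TRANSVERSE defect `δ` although the raw direction from `(0, 0)` to `(δ, γ)` has
window norm `δ + |γ|`, arbitrarily larger: the gauge quotient in miniature. [folklore] -/
theorem toy_relGauge {δ : ℝ} (hδ : 0 < δ) (γ : ℂ) : RelGauge toyRel toyMove toyN (0, 0) ((δ : ℂ), γ) δ := by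
  refine ⟨((δ : ℂ), 0), ?_, ?_, ?_⟩
  · simp [toyN, Complex.norm_real, Real.norm_eq_abs, abs_of_pos hδ, hδ]
  · simp [toyN, Complex.norm_real, Real.norm_eq_abs, abs_of_pos hδ]
  · simp [toyRel, toyMove]

/-- The RAW defect of the toy direction `(δ, γ)` is `|δ| + ‖γ‖`. [folklore] -/
theorem toy_rawDefect (δ : ℝ) (γ : ℂ) : toyN ((δ : ℂ), γ) = |δ| + ‖γ‖ := by
  simp [toyN, Complex.norm_real, Real.norm_eq_abs]

/-- The transport lemma instantiated on the toy: `‖δ − 0‖ ≤ (4(1 + r + w)/r)·δ`, for every gauge parameter `γ`. [folklore] -/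
theorem toy_transport {w r δ : ℝ} (hr : 0 < r) (hw : 0 ≤ w) (hδ : 0 < δ) (hδw : δ ≤ w) (γ : ℂ) :
    ‖toyFn ((δ : ℂ), γ) - toyFn (0, 0)‖ ≤ 4 * (1 + r + w) / r * δ :=
  transport_of_birthChart toy_gaugeInvariant (toy_birthSlice hr.le) toy_move_zero hr (by positivity)
    (show ((0 : ℂ), (0 : ℂ)) ∈ toyK by simp [toyK]) (toy_relGauge hδ γ) hδw

end Toy

end Literature.MathematicalPhysics.QuantumFieldTheory.Balaban1983to89.T4BirthChartTransport
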